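import Summits.HodgeConjecture.HodgeConjecture.Theorems.F0P3cStCharTSCasselmanCap          -- ★ p850760 (this seat): `character_eq_sum_exponents_of_dominant` (χ_π = χ_{π_N} pointwise, generic `G`)
import Summits.HodgeConjecture.HodgeConjecture.Theorems.F0P3cStCharTSShellsTTLevels       -- ★ p850453 (this seat): `exists_datum` (T1 levels: in `K_v`, deep, `w₀`-normalised, DOMINATED BY EVERY dominant chart point)
import Summits.HodgeConjecture.HodgeConjecture.Theorems.F0P3cStCharTSJacquetLine          -- ★ «JDIM2» `finrank_coinvariants_le_two`
import Summits.HodgeConjecture.HodgeConjecture.Theorems.F0P3cStCharTSTorusMultiset        -- ★ p848271 «TMULT» `exists_multiset_of_finrank_le_two`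
import Summits.HodgeConjecture.HodgeConjecture.Theorems.F0P2oN7OfCasselmanCriterion       -- ★ `u3_squareIntegrable_jacquetExponent_decay_holds` (Casselman's criterion, exponent form)
import Summits.HodgeConjecture.HodgeConjecture.Theorems.F0P3LocalIrrepAdmissibleOfCuspidal  -- ★ `isAdmissible_irrClass_quasiSplit_of_cuspidal`
import Summits.HodgeConjecture.HodgeConjecture.Theorems.F0P3LocalIrrepAdmissibleThree       -- ★ `isSupercuspidal_of_subsingleton_coinvariants`
import Literature.NumberTheory.Automorphic.CMBorelUnipotentIndexModulus                   -- ★ `isClosed_cmBorelTriple_N`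
import Literature.NumberTheory.Automorphic.JacquetNonzeroEmbedsNormalizedInd              -- ★ `torusU_mul_comm`
import HarnessLib

/-!
# F0 · P3c · line LH6 «StCharTS» — «L1M-SHELL-BOUND★» step (④b): THE CHARACTER OF A SQUARE-INTEGRABLE CLASS ON THE DOMINANT HALF OF THE SPLIT TORUS IS A SUM OF
# DECAYING EXPONENTS — `χ_σ(ι m) = Σ_i θ_i(ι m)` with `θ_i` continuous and `‖θ_i(t)‖ < ‖t₀‖` on the cone [Rogawski1990, §12.7 L. 12.7.2 (proof) p. 193; Casselman1977 Thm. 5.2]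

Cell `pub/hodgecm-mathlib`, crux H413 = `stmt-HodgeConjecture-24833` (`--supports`, helper lane), route HCCMUnconditional; seat LH6-p05 (g3); desk F0P3-plan (g15)
09:14:01Z split of road (L1M): ① ★ CASSELMAN-CAP, ② «L1M-SUM★» (LH6-p04 (g4)), ③ `hB` (★ HC-BOUNDED + «VDW-CORE»), ④a «EXP-SHELL-DECAY★» (LH6-p03 (g3)), ④b = THIS FILE.
THEOREMS ONLY, sorry-free, ★-only imports, no definition ∕ instance ∕ notation ∕ named fact.

THE MATHEMATICS.  `v` non-split (one place `w`); `σ` an irreducible class of `U(Φ₃)(L⁺_v)` square-integrable modulo the centre; `Θ : G → ℂ` a function that is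
locally constant at the regular elements and represents `Tr σ` on `C_c^∞(G)` — the (M1) clauses (iii)(iv) of ★ `Ch12Sec5Inputs.CharRegularity` read through the datum's
COMPAT (the integrator plugs `Θ := 𝔇.char σ`).  THEN there is a multiset `s` of characters `θ` of the diagonal torus `M_T` such that (`exists_exponents_char_torusChart`):
(a) each `θ` is CONTINUOUS; (b) each `θ` DECAYS on the dominant cone — `‖θ(t)‖ < ‖t₀‖` whenever `‖t₀‖ < 1` (★ `u3_squareIntegrable_jacquetExponent_decay` text
VERBATIM); (c) for every dominant chart point `m = (α, z)`, `|α_w| < 1`: `Θ(ι m) = Σ_{θ ∈ s} θ(ι m)`.  Here `s` is the exponent multiset of the (≤ 2-dimensional, ★ JDIM2)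
Jacquet module of a square-integrable representative (★ TMULT: trace = Σ θ, each `θ` with an eigen-functional `ψ`); continuity: the open stabiliser (★ `isSmooth_jacquetModule`)
of a `ψ`-non-null vector lies in `ker θ` (§1 `continuous_coe_of_eigenfunctional`); decay: `ψ` IS a non-zero `M_T`-map `π_N → ℂ_θ`, so ★ Casselman's criterion
(`F0P2oN7OfCasselmanCriterion.u3_squareIntegrable_jacquetExponent_decay_holds`) applies; the value: ★ CASSELMAN-CAP at `b := ι m`, dominant for the T1 datum of ★
`F0P3cStCharTSShellsTTLevels.exists_datum` (★ «DOM-BRIDGE»), `M_T` abelian (★ `torusU_mul_comm`), `ι m` regular (★ (H2c) `one_lt_v_trace_torusChart_iff` + ★ (H3″)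
`mem_hyperbolicSet_of_one_lt_v_trace`), admissibility ★ at a non-split place.  CONSUMERS: ④a turns (a)(b) into the geometric shell bound, and with `Δ(ι m)` (★ VDW)
LH6-p04's `hC`; the `n < 0` shells by `ω` at REGULAR points (★ CLASS-FN + ★ VDW-SYMM).
HONEST LABEL: count-neutral; HC_CM is proved only modulo the 7 printed citations (2 remaining: hLiu418 = stmt-HodgeConjecture-24832, h413 = stmt-HodgeConjecture-24833)
until rung 0 closes.

## References
* [Rogawski1990] J. D. Rogawski, *Automorphic Representations of Unitary Groups in Three Variables*, Ann. of Math. Stud. 123 (1990): §12.7 L. 12.7.2 (proof) p. 193;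
  §12.2 (2) pp. 173–174.
* [Casselman1977] W. Casselman, *Characters and Jacquet modules*, Math. Ann. 230 (1977), Thm. 5.2.
* [Casselman1995] W. Casselman, *Introduction to the theory of admissible representations of p-adic reductive groups* (1995 notes), Thm. 4.4.6, §3.1.
-/

set_option autoImplicit false
-- the mandated namespace has the single-problem summit's repeated segment (`HodgeConjecture.HodgeConjecture`)
set_option linter.dupNamespace false

noncomputable section

open NumberField IsDedekindDomain MeasureTheory Measure Topology Filter
open scoped NNReal ENNReal Pointwise MatrixGroups
open Literature.NumberTheory Literature.NumberTheory.Rogawski1990 Literature.NumberTheory.Automorphic Literature.NumberTheory.Automorphic.UnitaryGroup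
open Summit.HodgeConjecture.HodgeConjecture.Cruxes.H413 Summit.HodgeConjecture.HodgeConjecture.Cruxes.H413.F0P3cStCharTSTorusDefs

namespace Summit.HodgeConjecture.HodgeConjecture.Cruxes.H413.F0P3cStCharTSCharTorusValue

/-! ## §1 Generic: an eigencharacter of a smooth representation with a non-zero eigen-functional is continuous -/

/-- **EXPONENTS ARE CONTINUOUS.**  For a SMOOTH representation `τ` of a topological group `M` and a character `θ` with a non-zero eigen-functional `ψ`
(`ψ(τ(m) w) = θ(m)·ψ(w)`), the map `m ↦ θ(m) ∈ ℂ` is continuous: the open stabiliser of a `ψ`-non-null vector lies in `ker θ`, so `θ` is constant near `1`.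
[cite: Casselman1995, §3.1] [cite: BernsteinZelevinsky1977, §1.8] -/
theorem continuous_coe_of_eigenfunctional {M W : Type*} [Group M] [TopologicalSpace M] [IsTopologicalGroup M] [AddCommGroup W] [Module ℂ W]
    (τ : Representation ℂ M W) (hτ : τ.IsSmooth) (θ : M →* ℂˣ) (ψ : W →ₗ[ℂ] ℂ) (hψ : ψ ≠ 0)
    (heq : ∀ (m : M) (w : W), ψ (τ m w) = ((θ m : ℂˣ) : ℂ) * ψ w) :
    Continuous (fun m => ((θ m : ℂˣ) : ℂ)) := by
  obtain ⟨w₀, hw₀⟩ : ∃ w₀, ψ w₀ ≠ 0 := by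
    by_contra h
    exact hψ (LinearMap.ext fun w => Classical.byContradiction fun hw => h ⟨w, hw⟩)
  have hker : ∀ m ∈ τ.stabilizerSubgroup w₀, ((θ m : ℂˣ) : ℂ) = 1 := by
    intro m hm
    have h1 := heq m w₀
    rw [Representation.mem_stabilizerSubgroup] at hm
    rw [hm] at h1
    exact (mul_eq_right₀ hw₀).1 h1.symm
  have hev : (fun m => ((Units.coeHom ℂ).comp θ) m) =ᶠ[𝓝 (1 : M)] fun _ => (1 : ℂ) := by
    filter_upwards [(hτ w₀).mem_nhds (Subgroup.one_mem _)] with m hm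
    exact hker m hm
  exact continuous_of_continuousAt_one ((Units.coeHom ℂ).comp θ) (continuousAt_const.congr_of_eventuallyEq hev)

/-! ## §2 The CM instance: `χ_σ ∘ ι` on the dominant half of `M = E_vˣ × E¹_v` is a sum of decaying exponents -/

variable (L : Type) [Field L] [NumberField L] [IsCMField L] (v : HeightOneSpectrum (𝓞 ↥(maximalRealSubfield L)))

set_option maxHeartbeats 4000000 in  -- cross-spelling `whnf` `Gqs L v` ≡ `↥(unitaryGroupOfForm … (cmLocalForm L 3 v))` (measured class, as ★ NoncuspidalOfXIG)
set_option synthInstance.maxHeartbeats 400000 in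
/-- **«CHAR-TORUS-VALUE★» — the character of a square-integrable class on the dominant half of the split torus is a sum of continuous, decaying exponents.**
`σ` square-integrable modulo the centre; `Θ` locally constant at regular elements and representing `Tr σ` ((M1)(iii)(iv)).  Then `∃ s`, each `θ ∈ s` continuous with
`‖θ(t)‖ < ‖t₀‖` for `‖t₀‖ < 1`, and `Θ(ι m) = Σ_{θ ∈ s} θ(ι m)` for every `m` with `|m.1_w| < 1`.
[cite: Rogawski1990, §12.7 L. 12.7.2 (proof) p. 193; §12.2 (2) pp. 173–174] [cite: Casselman1977, Thm. 5.2] [cite: Casselman1995, Thm. 4.4.6] -/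
theorem exists_exponents_char_torusChart (hns : ∀ w' : PlacesOver L v, IsCMField.complexConj L • w'.1 = w'.1) (w : PlacesOver L v)
    [MeasurableSpace (Gqs L v)] [BorelSpace (Gqs L v)]
    [MeasurableSpace (Gqs L v ⧸ Subgroup.center (Gqs L v))] [BorelSpace (Gqs L v ⧸ Subgroup.center (Gqs L v))]
    (μZ : Measure (Gqs L v ⧸ Subgroup.center (Gqs L v))) [μZ.IsHaarMeasure]
    (νQv : Measure (Gqs L v)) [νQv.IsHaarMeasure]
    (σ : IrrClass (Gqs L v)) (hσ : σ.IsSquareIntegrable μZ)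
    (Θ : Gqs L v → ℂ) (hΘloc : ∀ x : Gqs L v, IsRegularElt (x.val : GL (Fin 3) (LocalRing L v)) → ∀ᶠ y in 𝓝 x, Θ y = Θ x)
    (hΘtr : ∀ φ : Gqs L v → ℂ, IsLocSmooth φ → σ.smoothTrace νQv φ = ∫ g, φ g * Θ g ∂νQv) :
    ∃ s : Multiset (↥(cmBorelTriple L 3 v).M →* ℂˣ),
      (∀ θ ∈ s, Continuous (fun t => ((θ t : ℂˣ) : ℂ)) ∧
        ∀ t : ↥(cmBorelTriple L 3 v).M,
          unitModulusChar (LocalRing L v) (torusEntry (conjLocal L (IsCMField.complexConj L) v) (cmLocalForm L 3 v) 0 t) < 1 →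
            ‖((θ t : ℂˣ) : ℂ)‖ < ((unitModulusChar (LocalRing L v) (torusEntry (conjLocal L (IsCMField.complexConj L) v) (cmLocalForm L 3 v) 0 t) : ℝ≥0) : ℝ)) ∧
      ∀ m : ((LocalRing L v)ˣ × ↥(normOneUnits (conjLocal L (IsCMField.complexConj L) v))), Valued.v ((m.1 : LocalRing L v) w) < 1 →
        Θ (((torusChart L v m : ↥(cmBorelTriple L 3 v).M) : ↥(unitaryGroupOfForm (conjLocal L (IsCMField.complexConj L) v) (cmLocalForm L 3 v))) : Gqs L v) =
          (s.map fun θ : ↥(cmBorelTriple L 3 v).M →* ℂˣ => ((θ (torusChart L v m) : ℂˣ) : ℂ)).sum := by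
  haveI := locallyCompactSpace_cmBorelU L 3 v
  have hw : IsCMField.complexConj L • w.1 = w.1 := hns w
  -- a square-integrable representative, admissible at the non-split place, with its (≤ 2-dimensional) Jacquet module and exponent multiset
  obtain ⟨r, rfl, hL2⟩ := hσ
  have hadm : r.ρ.IsAdmissible := (IrrClass.isAdmissible_mk r).1
    (F0P3LocalIrrepAdmissibleOfCuspidal.isAdmissible_irrClass_quasiSplit_of_cuspidal L v
      (F0P3LocalIrrepAdmissibleThree.isSupercuspidal_of_subsingleton_coinvariants L v hns) _)
  obtain ⟨hfd, h2⟩ := F0P3cStCharTSJacquetLine.finrank_coinvariants_le_two L v hns r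
  haveI := hfd
  have hTcomm : ∀ a b : ↥(cmBorelTriple L 3 v).M, a * b = b * a := fun a b => torusU_mul_comm _ _ a b
  obtain ⟨s, -, hs, hfun⟩ := @F0P3cStCharTSTorusMultiset.exists_multiset_of_finrank_le_two _ _ _ _ _ hfd
    (r.ρ.jacquetModule (cmBorelTriple L 3 v)) (fun a b => hTcomm a b) h2
  refine ⟨s, fun θ hθ => ?_, fun m hm => ?_⟩
  · -- continuity (§1) and decay (★ Casselman's criterion at the eigen-functional)
    obtain ⟨ψ, hψ, heq⟩ := hfun θ hθ
    have hcont : Continuous (fun t => ((θ t : ℂˣ) : ℂ)) :=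
      continuous_coe_of_eigenfunctional _ (Representation.isSmooth_jacquetModule r.ρ (cmBorelTriple L 3 v) r.isSmooth) θ ψ hψ heq
    refine ⟨hcont, fun t ht => ?_⟩
    have hf : ∀ (m : ↥(cmBorelTriple L 3 v).M) (x : ((cmBorelTriple L 3 v).restrict r.ρ).Coinvariants),
        ψ (r.ρ.jacquetModule (cmBorelTriple L 3 v) m x) =
          ((Representation.trivial ℂ ↥(torusU (conjLocal L (IsCMField.complexConj L) v) (cmLocalForm L 3 v)) ℂ).twist θ) m (ψ x) := by
      intro m x
      refine (heq m x).trans ?_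
      rw [Representation.twist_apply, Representation.trivial_apply, smul_eq_mul]
      rfl
    exact F0P2oN7OfCasselmanCriterion.u3_squareIntegrable_jacquetExponent_decay_holds L v hns μZ r.V r.ρ r.isIrreducible r.isSmooth hadm hL2 θ hcont
      (LinearMap.intertwiningMap_of_isIntertwiningMap (r.ρ.jacquetModule (cmBorelTriple L 3 v))
        ((Representation.trivial ℂ ↥(torusU (conjLocal L (IsCMField.complexConj L) v) (cmLocalForm L 3 v)) ℂ).twist θ) ψ hf) hψ t ht
  · -- the value at `ι m` (★ CASSELMAN-CAP over the T1 datum)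
    obtain ⟨𝓘, w₀, -, -, -, -, -, hdom⟩ := F0P3cStCharTSShellsTTLevels.exists_datum L v w hw hns
    -- regularity of `ι m` (off `M_c`: `|α_w| ≠ 1`)
    have hreg : IsRegularElt (((((torusChart L v m : ↥(cmBorelTriple L 3 v).M) : ↥(unitaryGroupOfForm (conjLocal L (IsCMField.complexConj L) v) (cmLocalForm L 3 v))) : Gqs L v)).val : GL (Fin 3) (LocalRing L v)) :=
      (F0P3cStCharTSHyperbolicCore.mem_hyperbolicSet_of_one_lt_v_trace L v hns w _
        ((F0P3cStCharTSHyperbolicSet.one_lt_v_trace_torusChart_iff L v hns w m).2 (ne_of_lt hm))).2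
    -- the organ's structures read on the matrix carrier (recipe of ★ CuspidalOfXIG ∕ NoncuspidalOfXIG)
    letI mU : MeasurableSpace ↥(unitaryGroupOfForm (conjLocal L (IsCMField.complexConj L) v) (cmLocalForm L 3 v)) := ‹MeasurableSpace (Gqs L v)›
    haveI bU : BorelSpace ↥(unitaryGroupOfForm (conjLocal L (IsCMField.complexConj L) v) (cmLocalForm L 3 v)) := ‹BorelSpace (Gqs L v)›
    haveI hU : (νQv : Measure ↥(unitaryGroupOfForm (conjLocal L (IsCMField.complexConj L) v) (cmLocalForm L 3 v))).IsHaarMeasure := ‹νQv.IsHaarMeasure›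
    have iTG : IsTopologicalGroup ↥(unitaryGroupOfForm (conjLocal L (IsCMField.complexConj L) v) (cmLocalForm L 3 v)) := inferInstance
    have iT2 : T2Space ↥(unitaryGroupOfForm (conjLocal L (IsCMField.complexConj L) v) (cmLocalForm L 3 v)) := inferInstance
    have key := @F0P3cStCharTSCasselmanCap.character_eq_sum_exponents_of_dominant _ _ _ iTG mU bU iT2
      (νQv : Measure ↥(unitaryGroupOfForm (conjLocal L (IsCMField.complexConj L) v) (cmLocalForm L 3 v))) hU r.V _ _ r.ρ hadm
      (cmBorelTriple L 3 v) (isClosed_cmBorelTriple_N L v) 𝓘 hfd s hs Θ (fun φ hφ => hΘtr φ hφ)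
      ((torusChart L v m : ↥(cmBorelTriple L 3 v).M) : ↥(unitaryGroupOfForm (conjLocal L (IsCMField.complexConj L) v) (cmLocalForm L 3 v)))
      (torusChart L v m).2 (fun m' hm' => congrArg Subtype.val (hTcomm ⟨m', hm'⟩ (torusChart L v m)))
      (fun n => (hdom m hm n).1) (fun n => (hdom m hm n).2.1) (fun n => (hdom m hm n).2.2) (hΘloc _ hreg)
    exact key

end Summit.HodgeConjecture.HodgeConjecture.Cruxes.H413.F0P3cStCharTSCharTorusValue

end
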